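import Literature.Computability.AlgebraicComplexity.BooleanGadgets
import Literature.Computability.AlgebraicComplexity.CircuitArithmetizationTau
import HarnessLib

/-!
# Boolean gadgets, constant-free: the comparison gadget and `(size, formal degree)` bounds

Companion of `BooleanGadgets.lean` (bit-vector gadgets of Valiant's criterion over a commutative
ring) for the CONSTANT-FREE criterion (Koiran 2004, Thm. 6.1 = Bürgisser 2009, Thm. 2.11, where
the witness family must lie in `VP⁰`: fan-in-two constant-free circuits of polynomial size AND
formal degree). Over `ℤ`:

* the comparison gadgets on two blocks of `n` bit polynomials `E, F` (little-endian):
  `eqAll n E F` (value `[e = f]`), `ltInd n E F` (value `[Nat.ofBits e < Nat.ofBits f]`, by the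
  least-significant-bit recursion `e < f ↔ tail e < tail f ∨ (tail e = tail f ∧ e₀ < f₀)`) and
  `leInd n E F = ltInd + eqAll` (value `[Nat.ofBits e ≤ Nat.ofBits f]`), with their values at
  Boolean points;
* `HasTauDeg` bounds (`ConstantFreeDegree.lean`) for `allZeroFrom`, `leadBit`, `lenInd`,
  `selProd`, `eqAll`, `ltInd`, `leInd` when the `E_t, F_t` are leaves (variables or sign
  constants, `HasTauDeg _ 0 1`; for `selProd` the `Y_t` too).

## References

* P. Koiran, *Valiant's model and the cost of computing integers*, Comput. Complexity 13 (2004),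
  Thm. 6.1 (the comparison polynomials `C_r(J, P)` of its proof).
* P. Bürgisser, *On defining integers and proving arithmetic circuit lower bounds* (2009) =
  ECCC TR06-113, Thm. 2.11, §2.2.
* P. Bürgisser, *Completeness and Reduction in Algebraic Complexity Theory* (2000), Prop. 2.20.
-/

noncomputable section

open MvPolynomial

universe u v w

namespace Literature.Computability.AlgebraicComplexity

open CircuitArith

namespace BoolGadgets

variable {β : Type w}

/-! ### The comparison gadgets -/

/-- `eqAll n E F = ∏_t [E_t = F_t]` by the least-significant-bit recursion. [cite: Koiran2004, proof of Thm. 6.1] -/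
def eqAll : (n : ℕ) → (Fin n → MvPolynomial β ℤ) → (Fin n → MvPolynomial β ℤ) → MvPolynomial β ℤ
  | 0, _, _ => 1
  | n + 1, E, F => eqInd (E 0) (F 0) * eqAll n (fun t => E t.succ) (fun t => F t.succ)

/-- `ltInd n E F`: the indicator of `Nat.ofBits e < Nat.ofBits f` (little-endian comparison:
`e < f ↔ tail e < tail f ∨ (tail e = tail f ∧ e₀ = 0 ∧ f₀ = 1)`). [cite: Koiran2004, proof of Thm. 6.1] -/
def ltInd : (n : ℕ) → (Fin n → MvPolynomial β ℤ) → (Fin n → MvPolynomial β ℤ) → MvPolynomial β ℤ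
  | 0, _, _ => 0
  | n + 1, E, F => ltInd n (fun t => E t.succ) (fun t => F t.succ) +
      eqAll n (fun t => E t.succ) (fun t => F t.succ) * ((1 - E 0) * F 0)

/-- `leInd n E F = ltInd + eqAll`: the indicator of `Nat.ofBits e ≤ Nat.ofBits f`. [cite: Koiran2004, proof of Thm. 6.1] -/
def leInd (n : ℕ) (E F : Fin n → MvPolynomial β ℤ) : MvPolynomial β ℤ :=
  ltInd n E F + eqAll n E F

section Eval

variable (x : β → ℤ)

/-- **`eqAll` at a Boolean point is `[e = f]`.** [folklore] -/
theorem eval_eqAll : ∀ (n : ℕ) (E F : Fin n → MvPolynomial β ℤ) (e f : Fin n → Bool),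
    (∀ t, eval x (E t) = toK ℤ (e t)) → (∀ t, eval x (F t) = toK ℤ (f t)) →
      eval x (eqAll n E F) = toK ℤ (decide (e = f))
  | 0, E, F, e, f, _, _ => by
    rw [eqAll, map_one, decide_eq_true (Subsingleton.elim e f)]; rfl
  | n + 1, E, F, e, f, hE, hF => by
    rw [eqAll, map_mul, eval_eqInd x _ _ (e 0) (f 0) (hE 0) (hF 0),
      eval_eqAll n _ _ (fun t => e t.succ) (fun t => f t.succ) (fun t => hE t.succ) (fun t => hF t.succ),
      ← toK_and]
    congr 1
    rw [Bool.eq_iff_iff, Bool.and_eq_true, beq_iff_eq, decide_eq_true_iff, decide_eq_true_iff]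
    constructor
    · rintro ⟨h0, ht⟩
      funext t
      cases t using Fin.cases with
      | zero => exact h0
      | succ t => exact congrFun ht t
    · rintro rfl; exact ⟨rfl, rfl⟩

/-- The arithmetic of one step of the little-endian comparison. [folklore] -/
theorem toK_lt_step (a b : ℕ) (e0 f0 : Bool) :
    toK ℤ (decide (a < b)) + toK ℤ (decide (a = b)) * ((1 - toK ℤ e0) * toK ℤ f0) =
      toK ℤ (decide (2 * a + e0.toNat < 2 * b + f0.toNat)) := by
  rcases Nat.lt_trichotomy a b with h | rfl | h
  · rw [decide_eq_true h, decide_eq_false (ne_of_lt h),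
      decide_eq_true (show 2 * a + e0.toNat < 2 * b + f0.toNat by cases e0 <;> cases f0 <;> simp <;> omega)]
    simp [toK]
  · cases e0 <;> cases f0 <;> simp [toK]
  · rw [decide_eq_false (Nat.lt_asymm h), decide_eq_false (ne_of_gt h),
      decide_eq_false (show ¬ 2 * a + e0.toNat < 2 * b + f0.toNat by cases e0 <;> cases f0 <;> simp <;> omega)]
    simp [toK]

/-- **`ltInd` at a Boolean point is `[Nat.ofBits e < Nat.ofBits f]`.** [folklore] -/
theorem eval_ltInd : ∀ (n : ℕ) (E F : Fin n → MvPolynomial β ℤ) (e f : Fin n → Bool),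
    (∀ t, eval x (E t) = toK ℤ (e t)) → (∀ t, eval x (F t) = toK ℤ (f t)) →
      eval x (ltInd n E F) = toK ℤ (decide (Nat.ofBits e < Nat.ofBits f))
  | 0, E, F, e, f, _, _ => by simp [ltInd, toK]
  | n + 1, E, F, e, f, hE, hF => by
    rw [ltInd, map_add, map_mul, map_mul, map_sub, map_one,
      eval_ltInd n _ _ (fun t => e t.succ) (fun t => f t.succ) (fun t => hE t.succ) (fun t => hF t.succ),
      eval_eqAll x n _ _ (fun t => e t.succ) (fun t => f t.succ) (fun t => hE t.succ) (fun t => hF t.succ),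
      hE 0, hF 0, Nat.ofBits_succ, Nat.ofBits_succ]
    have htail : ((fun t : Fin n => e t.succ) = fun t => f t.succ) ↔
        Nat.ofBits (fun t : Fin n => e t.succ) = Nat.ofBits (fun t : Fin n => f t.succ) :=
      ⟨fun h => congrArg Nat.ofBits h, fun h => ofBits_injective h⟩
    rw [Bool.decide_congr htail]
    exact toK_lt_step _ _ (e 0) (f 0)

/-- **`leInd` at a Boolean point is `[Nat.ofBits e ≤ Nat.ofBits f]`.** [folklore] -/
theorem eval_leInd (n : ℕ) (E F : Fin n → MvPolynomial β ℤ) (e f : Fin n → Bool)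
    (hE : ∀ t, eval x (E t) = toK ℤ (e t)) (hF : ∀ t, eval x (F t) = toK ℤ (f t)) :
    eval x (leInd n E F) = toK ℤ (decide (Nat.ofBits e ≤ Nat.ofBits f)) := by
  rw [leInd, map_add, eval_ltInd x n E F e f hE hF, eval_eqAll x n E F e f hE hF]
  have hinj : e = f ↔ Nat.ofBits e = Nat.ofBits f := ⟨fun h => congrArg _ h, fun h => ofBits_injective h⟩
  rcases Nat.lt_trichotomy (Nat.ofBits e) (Nat.ofBits f) with h | h | h
  · rw [decide_eq_true h, decide_eq_false (fun h' => by rw [hinj] at h'; omega), decide_eq_true h.le]; simp [toK]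
  · rw [decide_eq_false (by omega), decide_eq_true (hinj.2 h), decide_eq_true h.le]; simp [toK]
  · rw [decide_eq_false (by omega), decide_eq_false (fun h' => by rw [hinj] at h'; omega),
      decide_eq_false (by omega)]; simp [toK]

end Eval

/-! ### `(size, formal degree)` of the gadgets over `ℤ` -/

section Cost

variable {m : ℕ} {E : Fin m → MvPolynomial β ℤ} (hE : ∀ t, HasTauDeg (E t) 0 1)
include hE

/-- `allZeroFrom E ℓ`: `(3 m, m + 1)`. [cite: Burgisser2006, §2.2] -/
theorem hasTauDeg_allZeroFrom (ℓ : ℕ) : HasTauDeg (allZeroFrom E ℓ) (3 * m) (m + 1) := by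
  unfold allZeroFrom
  have h := HasTauDeg.finset_prod ((Finset.univ : Finset (Fin m)).filter fun t => ℓ ≤ t.val)
    (s := fun _ => 2) (d := 1) fun t _ => by simpa using (hE t).one_sub
  refine h.mono ?_ ?_
  · have hc := Finset.card_filter_le (Finset.univ : Finset (Fin m)) (fun t => ℓ ≤ t.val)
    rw [Finset.card_univ, Fintype.card_fin] at hc
    simp only [Finset.sum_const, smul_eq_mul]
    omega
  · have hc := Finset.card_filter_le (Finset.univ : Finset (Fin m)) (fun t => ℓ ≤ t.val)
    rw [Finset.card_univ, Fintype.card_fin] at hc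
    simpa using hc

/-- `leadBit E ℓ`: `(0, 1)`. [cite: Burgisser2006, §2.2] -/
theorem hasTauDeg_leadBit (ℓ : ℕ) : HasTauDeg (leadBit E ℓ) 0 1 := by
  unfold leadBit
  split_ifs
  · exact HasTauDeg.one
  · exact hE _
  · exact HasTauDeg.zero

/-- `lenInd E ℓ`: `(3 m + 1, m + 2)`. [cite: Burgisser2006, §2.2] -/
theorem hasTauDeg_lenInd (ℓ : ℕ) : HasTauDeg (lenInd E ℓ) (3 * m + 1) (m + 2) := by
  unfold lenInd
  exact ((hasTauDeg_leadBit hE ℓ).mul (hasTauDeg_allZeroFrom hE ℓ)).mono (by omega) (by omega)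

omit hE in
/-- `selProd E Y` for leaves `E_t, Y_t`: `(6 n, 2 n + 1)`. [cite: Burgisser2006, §2.2] -/
theorem hasTauDeg_selProd {n : ℕ} {E Y : Fin n → MvPolynomial β ℤ} (hE : ∀ t, HasTauDeg (E t) 0 1)
    (hY : ∀ t, HasTauDeg (Y t) 0 1) : HasTauDeg (selProd E Y) (6 * n) (2 * n + 1) := by
  unfold selProd
  have h := HasTauDeg.finset_prod (Finset.univ : Finset (Fin n)) (s := fun _ => 4) (d := 2)
    fun t _ => (((hE t).mul (hY t)).add (hE t).one_sub).mono (by omega) (by omega)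
  simp only [Finset.sum_const, Finset.card_univ, Fintype.card_fin, smul_eq_mul] at h
  exact h.mono (by omega) (by omega)

omit hE in
/-- `eqAll n E F` for leaves: `(8 n, 2 n + 1)`. [cite: Burgisser2006, §2.2] -/
theorem hasTauDeg_eqAll : ∀ (n : ℕ) {E F : Fin n → MvPolynomial β ℤ}, (∀ t, HasTauDeg (E t) 0 1) →
    (∀ t, HasTauDeg (F t) 0 1) → HasTauDeg (eqAll n E F) (8 * n) (2 * n + 1)
  | 0, _, _, _, _ => by simpa [eqAll] using (HasTauDeg.one (σ := β))
  | n + 1, E, F, hE, hF => by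
    rw [eqAll]
    have h := (hasTauDeg_eqInd (hE 0) (hF 0)).mul (hasTauDeg_eqAll n (fun t => hE t.succ) (fun t => hF t.succ))
    exact h.mono (by omega) (by omega)

omit hE in
/-- `ltInd n E F` for leaves: `(8 n² + 4 n, 2 n + 2)`. [cite: Burgisser2006, §2.2] -/
theorem hasTauDeg_ltInd : ∀ (n : ℕ) {E F : Fin n → MvPolynomial β ℤ}, (∀ t, HasTauDeg (E t) 0 1) →
    (∀ t, HasTauDeg (F t) 0 1) → HasTauDeg (ltInd n E F) (8 * n * n + 4 * n) (2 * n + 2)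
  | 0, _, _, _, _ => by simpa [ltInd] using (HasTauDeg.zero (σ := β)).mono le_rfl (by omega)
  | n + 1, E, F, hE, hF => by
    rw [ltInd]
    have h := (hasTauDeg_ltInd n (fun t => hE t.succ) (fun t => hF t.succ)).add
      ((hasTauDeg_eqAll n (fun t => hE t.succ) (fun t => hF t.succ)).mul ((hE 0).one_sub.mul (hF 0)))
    refine h.mono ?_ (by omega)
    have : 8 * n * n + 4 * n + (8 * n + (0 + 2 + 0 + 1) + 1) + 1 ≤ 8 * (n + 1) * (n + 1) + 4 * (n + 1) := by
      nlinarith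
    exact this

omit hE in
/-- `leInd n E F` for leaves: `(8 n² + 12 n + 1, 2 n + 2)`. [cite: Burgisser2006, §2.2] -/
theorem hasTauDeg_leInd (n : ℕ) {E F : Fin n → MvPolynomial β ℤ} (hE : ∀ t, HasTauDeg (E t) 0 1)
    (hF : ∀ t, HasTauDeg (F t) 0 1) : HasTauDeg (leInd n E F) (8 * n * n + 12 * n + 1) (2 * n + 2) := by
  unfold leInd
  exact ((hasTauDeg_ltInd n hE hF).add (hasTauDeg_eqAll n hE hF)).mono (by omega) (by omega)

end Cost

end BoolGadgets

end Literature.Computability.AlgebraicComplexity
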